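import Literature.AlgebraicGeometry.Resolution.NeronPopescuDesingularization
import Literature.AlgebraicGeometry.Resolution.ArtinApproximationAffineLemmas
import Literature.AlgebraicGeometry.Resolution.AdicNoetherian
import Mathlib.RingTheory.MvPolynomial.Basic
import HarnessLib

/-!
# Artin approximation over étale neighbourhoods: the affine form (Stacks 07QZ)

Topic: `Literature/AlgebraicGeometry/Resolution`. The ring-theoretic heart of M. Artin's
algebraic approximation theorem in the étale-neighbourhood form (Artin 1969, Cor. 2.1 =
`Artin1969EtaleApproximation`), PROVED from the two named facts of
`NeronPopescuDesingularization.lean` (Popescu's General Néron desingularisation, Stacks 07GC, and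
the étale lifting lemma Stacks 07M7) along the printed proof of Stacks, Tag 07QZ (*Smoothing Ring
Maps*, Thm. 13.2), but over an AFFINE rather than a local base, which is what the scheme
statement needs:

> Let `B` be a Noetherian ring, `𝔭` a prime, `R = B_𝔭` (any localisation at `𝔭`) with
> `B → R^` regular (e.g. `B` a G-ring), `f₁, …, f_m ∈ B[x₁, …, x_n]`, `(a₁, …, a_n)` a solution
> in `R^` and `N ≥ 0`. Then there are an étale `B → B'`, a prime `𝔭'` of `B'` over `𝔭` with
> `κ(𝔭) = κ(𝔭')`, and a solution `(b₁, …, b_n)` in `B'` with `aᵢ - bᵢ ∈ 𝔪'^N`.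

Proof (Stacks 07QZ): write `aᵢ ≡ cᵢ/tᵢ (mod 𝔪^N)`, `𝔭^N = (d₁, …, d_M)`, and enlarge the system by
`tᵢ xᵢ - cᵢ - Σ_l d_l x_{il} = 0`, which the `aᵢ` solve in `R^` (`ker(R^ → R/𝔪^N) = 𝔪^N R^`);
solvability of the enlarged system in any `B'` as above forces the congruence. Let
`A = B[x]/(f, g)` with its point `A → R^`; by Popescu (`B → R^` regular) it factors through a
smooth `B`-algebra `C`; the composite `C → R^ → κ(𝔭)` descends, for some `t ∉ 𝔭`, to a
`B_t`-algebra map `B_t ⊗_B C → B_t/𝔭B_t` (`exists_away_section`); Stacks 07M7 over `B_t` with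
the ideal `𝔭B_t` gives an étale `B_t → B'` with `B_t/𝔭B_t ≅ B'/𝔭B'` and a `B_t`-map
`B_t ⊗_B C → B'`; the images of the `xᵢ` are the solution, `𝔭' = 𝔭B'`.

* `exists_approximation_data` — the choice of `cᵢ, tᵢ, d_l` and of the solution of the enlarged
  system in `R^`.
* `exists_sub_mem_maximalIdeal_of_quotientMap_surjective` — `κ(𝔭) → κ(𝔭')` is onto, in the
  form: every element of a localisation `R'` of `B'` at `𝔭'` is congruent mod `𝔪'` to the image
  of an element of `R`.
* `sub_mem_maximalIdeal_pow_of_eq_sum` — the enlarged equations force `bᵢ ≡ aᵢ (mod 𝔪'^N)`.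
* `exists_etale_solution_of_isRegularHom` — the theorem above (conditional on the two named
  facts), with the local conclusions stated for every localisation `R'` of `B'` at `𝔭'` and every
  ring map `φ : R → R'` compatible with `B → B'` (so that it applies verbatim to stalks of
  schemes); `exists_etale_solution_of_isGRing` — the same for a G-ring `B`.

[cite: StacksProject, Tag 07QZ]; [cite: Artin1969, Cor. 2.1, p. 27]
-/

noncomputable section

open IsLocalRing TensorProduct

namespace Literature.AlgebraicGeometry.Resolution

universe u

/-! ## Step 1: approximation data -/

section Data

variable {B : Type u} [CommRing B] [IsNoetherianRing B] (p : Ideal B) [p.IsPrime]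
  (R : Type u) [CommRing R] [IsLocalRing R] [Algebra B R] [IsLocalization.AtPrime R p]

/-- **Approximation data** (Stacks 07QZ, first paragraph of the proof). For `ȳᵢ ∈ R^`
(`R` a localisation of the Noetherian ring `B` at `𝔭`, `𝔪 = 𝔭R`) and `N ≥ 0` there are
`aᵢ ∈ R` with `ȳᵢ ≡ aᵢ (mod 𝔪^N)`, fractions `aᵢ = bᵢ/tᵢ` (`tᵢ ∉ 𝔭`), generators
`d₁, …, d_M` of `𝔭^N` and `z_{il} ∈ R^` with `tᵢ ȳᵢ - bᵢ = Σ_l d_l z_{il}` in `R^`.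
[cite: StacksProject, Tag 07QZ (proof)] -/
theorem exists_approximation_data {ι : Type} [Finite ι]
    (ybar : ι → AdicCompletion (maximalIdeal R) R) (N : ℕ) :
    ∃ (a : ι → R) (b t : ι → B) (M : ℕ) (d : Fin M → B)
      (z : ι → Fin M → AdicCompletion (maximalIdeal R) R),
      (∀ i, AdicCompletion.evalₐ (maximalIdeal R) N (ybar i) = Ideal.Quotient.mk _ (a i)) ∧
      (∀ i, t i ∉ p) ∧
      (∀ i, a i * algebraMap B R (t i) = algebraMap B R (b i)) ∧
      (∀ l, d l ∈ p ^ N) ∧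
      ∀ i, algebraMap B _ (t i) * ybar i - algebraMap B _ (b i) =
        ∑ l, algebraMap B (AdicCompletion (maximalIdeal R) R) (d l) * z i l := by
  classical
  haveI : IsNoetherianRing R := IsLocalization.isNoetherianRing p.primeCompl R inferInstance
  -- `aᵢ`
  have ha : ∀ i, ∃ a : R,
      AdicCompletion.evalₐ (maximalIdeal R) N (ybar i) = Ideal.Quotient.mk _ a := fun i => by
    obtain ⟨a, ha⟩ :=
      Ideal.Quotient.mk_surjective (AdicCompletion.evalₐ (maximalIdeal R) N (ybar i))
    exact ⟨a, ha.symm⟩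
  choose a ha using ha
  -- `aᵢ = bᵢ / tᵢ`
  have hbt : ∀ i, ∃ (b : B) (t : p.primeCompl), IsLocalization.mk' R b t = a i := fun i => by
    obtain ⟨⟨b, t⟩, h⟩ := IsLocalization.mk'_surjective p.primeCompl (a i)
    exact ⟨b, t, h⟩
  choose b t hbt using hbt
  -- generators of `𝔭^N`
  obtain ⟨M, d, hd⟩ := Submodule.fg_iff_exists_fin_generating_family.mp
    (IsNoetherian.noetherian (p ^ N) : (p ^ N).FG)
  have hdmem : ∀ l, d l ∈ p ^ N := fun l => by
    rw [← hd]
    exact Ideal.subset_span ⟨l, rfl⟩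
  -- `ȳᵢ - aᵢ ∈ 𝔪^N R^ = 𝔭^N R^ = (d_l) R^`
  have e1 : maximalIdeal R ^ N = (p ^ N).map (algebraMap B R) := by
    rw [Ideal.map_pow, IsLocalization.AtPrime.map_eq_maximalIdeal p R]
  have hmN : (maximalIdeal R).map (algebraMap R (AdicCompletion (maximalIdeal R) R)) ^ N =
      Ideal.span (Set.range fun l => algebraMap B (AdicCompletion (maximalIdeal R) R) (d l)) :=
    calc (maximalIdeal R).map (algebraMap R (AdicCompletion (maximalIdeal R) R)) ^ N
        = (maximalIdeal R ^ N).map (algebraMap R (AdicCompletion (maximalIdeal R) R)) :=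
          (Ideal.map_pow _ _ N).symm
      _ = ((p ^ N).map (algebraMap B R)).map (algebraMap R (AdicCompletion (maximalIdeal R) R)) := by
          rw [e1]
      _ = (p ^ N).map (algebraMap B (AdicCompletion (maximalIdeal R) R)) := by
          rw [Ideal.map_map, ← IsScalarTower.algebraMap_eq]
      _ = Ideal.span (Set.range fun l => algebraMap B (AdicCompletion (maximalIdeal R) R) (d l)) := by
          rw [← hd, Ideal.span, Ideal.map_span, ← Set.range_comp]
          rfl
  have hz : ∀ i, ∃ c : Fin M → AdicCompletion (maximalIdeal R) R,
      ∑ l, c l * algebraMap B _ (d l) = ybar i - algebraMap R _ (a i) := fun i => by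
    have hmem := AdicCompletion.sub_of_mem_pow_map_of_evalₐ_eq (maximalIdeal R)
      (maximalIdeal R).fg_of_isNoetherianRing (ybar i) (a i) (ha i)
    rw [hmN, Ideal.mem_span_range_iff_exists_fun] at hmem
    obtain ⟨c, hc⟩ := hmem
    exact ⟨c, hc⟩
  choose c hc using hz
  refine ⟨a, b, fun i => (t i : B), M, d, fun i l => algebraMap B _ (t i) * c i l, ha,
    fun i => (t i).2, fun i => ?_, hdmem, fun i => ?_⟩
  · rw [← hbt i, IsLocalization.mk'_spec]
  · have h1 : algebraMap B (AdicCompletion (maximalIdeal R) R) (t i) * algebraMap R _ (a i) =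
        algebraMap B _ (b i) := by
      rw [IsScalarTower.algebraMap_apply B R (AdicCompletion (maximalIdeal R) R) (t i : B),
        IsScalarTower.algebraMap_apply B R (AdicCompletion (maximalIdeal R) R) (b i),
        ← map_mul, mul_comm, ← hbt i, IsLocalization.mk'_spec]
    change algebraMap B _ (t i : B) * ybar i - algebraMap B _ (b i) = _
    calc algebraMap B (AdicCompletion (maximalIdeal R) R) (t i) * ybar i - algebraMap B _ (b i)
        = algebraMap B _ (t i : B) * (ybar i - algebraMap R _ (a i)) := by rw [← h1]; ring
      _ = algebraMap B _ (t i : B) * ∑ l, c i l * algebraMap B _ (d l) := by rw [hc i]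
      _ = ∑ l, algebraMap B _ (d l) * (algebraMap B _ (t i : B) * c i l) := by
          rw [Finset.mul_sum]
          refine Finset.sum_congr rfl fun l _ => ?_
          ring

end Data

/-! ## Step 2: the local conclusions -/

section Local

/-- Elements of `B ∖ 𝔭` become units in `R' = B'_{𝔭'}` (`𝔭' ∩ B = 𝔭`). [folklore] -/
theorem isUnit_algebraMap_algebraMap_of_notMem {B B' R' : Type u} [CommRing B] [CommRing B'] [CommRing R']
    (p : Ideal B) [Algebra B B'] (p' : Ideal B') [p'.IsPrime] (hp'B : p'.comap (algebraMap B B') = p)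
    [Algebra B' R'] [IsLocalization.AtPrime R' p'] {s : B} (hs : s ∉ p) :
    IsUnit (algebraMap B' R' (algebraMap B B' s)) := by
  refine IsLocalization.map_units R' (⟨algebraMap B B' s, ?_⟩ : p'.primeCompl)
  change algebraMap B B' s ∉ p'
  rw [← Ideal.mem_comap, hp'B]
  exact hs

/-- `φ` maps `𝔪 = 𝔭R` into `𝔪' = 𝔭'R'`. [folklore] -/
theorem map_maximalIdeal_le_of_comp_eq {B B' R R' : Type u} [CommRing B] [CommRing B'] [CommRing R]
    [CommRing R'] (p : Ideal B) [p.IsPrime] [Algebra B R] [IsLocalRing R] [IsLocalization.AtPrime R p]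
    [Algebra B B'] (p' : Ideal B') [p'.IsPrime] (hp'B : p'.comap (algebraMap B B') = p)
    [Algebra B' R'] [IsLocalRing R'] [IsLocalization.AtPrime R' p']
    (φ : R →+* R') (hφ : φ.comp (algebraMap B R) = (algebraMap B' R').comp (algebraMap B B')) :
    (maximalIdeal R).map φ ≤ maximalIdeal R' := by
  rw [← IsLocalization.AtPrime.map_eq_maximalIdeal p R, Ideal.map_map, hφ, ← Ideal.map_map,
    ← IsLocalization.AtPrime.map_eq_maximalIdeal p' R']
  exact Ideal.map_mono (Ideal.map_le_iff_le_comap.mpr hp'B.ge)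

/-- `φ` is compatible with `B → B' → R'` elementwise. [folklore] -/
theorem map_algebraMap_eq_of_comp_eq {B B' R R' : Type u} [CommRing B] [CommRing B'] [CommRing R]
    [CommRing R'] [Algebra B R] [Algebra B B'] [Algebra B' R']
    (φ : R →+* R') (hφ : φ.comp (algebraMap B R) = (algebraMap B' R').comp (algebraMap B B'))
    (x : B) : φ (algebraMap B R x) = algebraMap B' R' (algebraMap B B' x) := by
  have := congrArg (fun f : B →+* R' => f x) hφ
  simpa using this

/-- **Trivial residue extension** (Stacks 07QZ: `κ(𝔪) = κ(𝔪')`), in the form used for schemes: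
if `B_t/𝔭B_t → B'/𝔭B'`-classes are all hit (`B_t → B'`, `𝔭' ⊇ 𝔭B'` with `𝔭' ∩ B = 𝔭`,
and `B_t/𝔭B_t → B'/𝔭'` onto), then every element of a localisation `R'` of `B'` at `𝔭'` is
congruent modulo `𝔪'` to the image of an element of `R = B_𝔭` under any ring map `φ : R → R'`
compatible with `B → B'`. [cite: StacksProject, Tag 07QZ (proof)] -/
theorem exists_sub_mem_maximalIdeal_of_surjective {B Bt B' R R' : Type u} [CommRing B]
    [CommRing Bt] [CommRing B'] [CommRing R] [CommRing R'] (p : Ideal B) [p.IsPrime]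
    [Algebra B R] [IsLocalRing R] [IsLocalization.AtPrime R p]
    (t : B) (ht : t ∉ p) [Algebra B Bt] [IsLocalization.Away t Bt] [Algebra Bt B'] [Algebra B B']
    [IsScalarTower B Bt B'] (p' : Ideal B') [p'.IsPrime] (hp'B : p'.comap (algebraMap B B') = p)
    [Algebra B' R'] [IsLocalRing R'] [IsLocalization.AtPrime R' p']
    (φ : R →+* R') (hφ : φ.comp (algebraMap B R) = (algebraMap B' R').comp (algebraMap B B'))
    (hsurj : ∀ b' : B', ∃ β : Bt, algebraMap Bt B' β - b' ∈ p') (x : R') :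
    ∃ r : R, x - φ r ∈ maximalIdeal R' := by
  classical
  -- the subfield `k₀ = im(R → κ(𝔪'))`
  let g : R →+* ResidueField R' := (residue R').comp φ
  have hgm : ∀ r ∈ maximalIdeal R, g r = 0 := fun r hr => by
    change residue R' (φ r) = 0
    rw [residue_eq_zero_iff]
    exact map_maximalIdeal_le_of_comp_eq p p' hp'B φ hφ (Ideal.mem_map_of_mem φ hr)
  let k₀ : Subfield (ResidueField R') :=
    { toSubring := g.range
      inv_mem' := by
        rintro _ ⟨r, rfl⟩
        by_cases hr : r ∈ maximalIdeal R
        · refine ⟨0, ?_⟩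
          change g 0 = (g r)⁻¹
          rw [hgm r hr, inv_zero, map_zero]
        · obtain ⟨v, rfl⟩ := (IsLocalRing.notMem_maximalIdeal.mp hr)
          refine ⟨((v⁻¹ : Rˣ) : R), ?_⟩
          have hmul : g ((v⁻¹ : Rˣ) : R) * g (v : R) = 1 := by
            rw [← map_mul, Units.inv_mul, map_one]
          exact eq_inv_of_mul_eq_one_left hmul }
  have hk₀ : ∀ y : ResidueField R', y ∈ k₀ ↔ ∃ r, g r = y := fun y => Iff.rfl
  -- images of `B` lie in `k₀`, images of `B ∖ 𝔭` are nonzero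
  let gB : B →+* ResidueField R' := (residue R').comp ((algebraMap B' R').comp (algebraMap B B'))
  have hgB : ∀ x : B, gB x ∈ k₀ := fun x =>
    ⟨algebraMap B R x, by
      change residue R' (φ (algebraMap B R x)) = residue R' (algebraMap B' R' (algebraMap B B' x))
      rw [map_algebraMap_eq_of_comp_eq φ hφ]⟩
  have hgB0 : ∀ s : B, s ∉ p → gB s ≠ 0 := fun s hs h => by
    change residue R' (algebraMap B' R' (algebraMap B B' s)) = 0 at h
    rw [residue_eq_zero_iff] at h
    exact (mem_nonunits_iff.mp ((IsLocalRing.mem_maximalIdeal _).mp h))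
      (isUnit_algebraMap_algebraMap_of_notMem p p' hp'B hs)
  -- images of `B_t` lie in `k₀`
  let gt : Bt →+* ResidueField R' :=
    (residue R').comp ((algebraMap B' R').comp (algebraMap Bt B'))
  have hgtB : ∀ x : B, gt (algebraMap B Bt x) = gB x := fun x => by
    change residue R' (algebraMap B' R' (algebraMap Bt B' (algebraMap B Bt x))) =
      residue R' (algebraMap B' R' (algebraMap B B' x))
    rw [← IsScalarTower.algebraMap_apply B Bt B']
  have hgt : ∀ β : Bt, gt β ∈ k₀ := fun β => by
    obtain ⟨⟨β₀, s⟩, rfl⟩ := IsLocalization.mk'_surjective (Submonoid.powers t) β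
    have hs : (s : B) ∉ p := by
      obtain ⟨n, hn⟩ := (Submonoid.mem_powers_iff _ _).mp s.2
      rw [← hn]
      exact fun h => ht (‹p.IsPrime›.mem_of_pow_mem n h)
    have h1 : gt (IsLocalization.mk' Bt β₀ s) * gB s = gB β₀ := by
      rw [← hgtB, ← hgtB, ← map_mul, IsLocalization.mk'_spec]
    change gt (IsLocalization.mk' Bt β₀ s) ∈ k₀
    rw [eq_div_of_mul_eq (hgB0 s hs) h1]
    exact div_mem (hgB β₀) (hgB (s : B))
  -- images of `B'` agree modulo `𝔪'` with images of `B_t`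
  let gB' : B' →+* ResidueField R' := (residue R').comp (algebraMap B' R')
  have hgB'p : ∀ z ∈ p', gB' z = 0 := fun z hz => by
    change residue R' (algebraMap B' R' z) = 0
    rw [residue_eq_zero_iff, IsLocalization.AtPrime.to_map_mem_maximal_iff R' p']
    exact hz
  have hgB' : ∀ b' : B', gB' b' ∈ k₀ := fun b' => by
    obtain ⟨β, hβ⟩ := hsurj b'
    have h0 := hgB'p _ hβ
    rw [map_sub, sub_eq_zero] at h0
    change gB' b' ∈ k₀
    rw [← h0]
    exact hgt β
  -- conclusion: `x = b'/u'` has residue class in the field `k₀`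
  obtain ⟨⟨b', u'⟩, rfl⟩ := IsLocalization.mk'_surjective p'.primeCompl x
  have hu' : gB' (u' : B') ≠ 0 := fun h => by
    change residue R' (algebraMap B' R' u') = 0 at h
    rw [residue_eq_zero_iff] at h
    exact (mem_nonunits_iff.mp ((IsLocalRing.mem_maximalIdeal _).mp h))
      (IsLocalization.map_units R' u')
  have hx : residue R' (IsLocalization.mk' R' b' u') = gB' b' / gB' (u' : B') := by
    refine eq_div_of_mul_eq hu' ?_
    change residue R' _ * residue R' _ = residue R' _
    rw [← map_mul, IsLocalization.mk'_spec]
  have hmem : residue R' (IsLocalization.mk' R' b' u') ∈ k₀ := by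
    rw [hx]
    exact div_mem (hgB' b') (hgB' u')
  obtain ⟨r, hr⟩ := hmem
  refine ⟨r, ?_⟩
  rw [← residue_eq_zero_iff, map_sub, sub_eq_zero]
  exact hr.symm

/-- **The enlarged equations force the congruence** (Stacks 07QZ: "it follows that
`bᵢ = cᵢ + Σ b_{il} d_l` is a solution … congruent to `aᵢ` modulo `(𝔪')^N`"): if `a = b/t` in
`R` (`t ∉ 𝔭`), `d_l ∈ 𝔭^N`, and `t y - b = Σ_l d_l w_l` in `B'`, then `y ≡ φ a₂ (mod 𝔪'^N)`
in `R'` for every `a₂ ≡ a (mod 𝔪^N)`. [cite: StacksProject, Tag 07QZ (proof)] -/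
theorem sub_mem_maximalIdeal_pow_of_eq_sum {B B' R R' : Type u} [CommRing B] [CommRing B']
    [CommRing R] [CommRing R'] (p : Ideal B) [p.IsPrime] [Algebra B R] [IsLocalRing R]
    [IsLocalization.AtPrime R p] [Algebra B B'] (p' : Ideal B') [p'.IsPrime]
    (hp'B : p'.comap (algebraMap B B') = p) [Algebra B' R'] [IsLocalRing R']
    [IsLocalization.AtPrime R' p']
    (φ : R →+* R') (hφ : φ.comp (algebraMap B R) = (algebraMap B' R').comp (algebraMap B B'))
    {N M : ℕ} {t b : B} (ht : t ∉ p) {a : R}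
    (hab : a * algebraMap B R t = algebraMap B R b) {d : Fin M → B} (hd : ∀ l, d l ∈ p ^ N)
    {y : B'} {w : Fin M → B'}
    (hy : algebraMap B B' t * y - algebraMap B B' b = ∑ l, algebraMap B B' (d l) * w l)
    {a₂ : R} (ha₂ : a₂ - a ∈ maximalIdeal R ^ N) :
    algebraMap B' R' y - φ a₂ ∈ maximalIdeal R' ^ N := by
  have hφN : (maximalIdeal R ^ N).map φ ≤ maximalIdeal R' ^ N := by
    rw [Ideal.map_pow]
    exact Ideal.pow_right_mono (map_maximalIdeal_le_of_comp_eq p p' hp'B φ hφ) N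
  have h2 : φ (a₂ - a) ∈ maximalIdeal R' ^ N := hφN (Ideal.mem_map_of_mem φ ha₂)
  have hpR' : ∀ x ∈ p, algebraMap B' R' (algebraMap B B' x) ∈ maximalIdeal R' := fun x hx => by
    rw [IsLocalization.AtPrime.to_map_mem_maximal_iff R' p', ← Ideal.mem_comap, hp'B]
    exact hx
  have hdR' : ∀ l, algebraMap B' R' (algebraMap B B' (d l)) ∈ maximalIdeal R' ^ N := fun l => by
    have hle : (p ^ N).map ((algebraMap B' R').comp (algebraMap B B')) ≤ maximalIdeal R' ^ N := by
      rw [Ideal.map_pow]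
      refine Ideal.pow_right_mono ?_ N
      rw [Ideal.map_le_iff_le_comap]
      intro x hx
      exact hpR' x hx
    exact hle (Ideal.mem_map_of_mem _ (hd l))
  have h1 : algebraMap B' R' (algebraMap B B' t) * (algebraMap B' R' y - φ a) ∈
      maximalIdeal R' ^ N := by
    have e1 : algebraMap B' R' (algebraMap B B' t) * φ a = algebraMap B' R' (algebraMap B B' b) := by
      rw [← map_algebraMap_eq_of_comp_eq φ hφ t, ← map_algebraMap_eq_of_comp_eq φ hφ b, ← map_mul,
        mul_comm, hab]
    have e : algebraMap B' R' (algebraMap B B' t) * (algebraMap B' R' y - φ a) =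
        ∑ l, algebraMap B' R' (algebraMap B B' (d l)) * algebraMap B' R' (w l) := by
      rw [mul_sub, e1, ← map_mul, ← map_sub, hy, map_sum]
      simp only [map_mul]
    rw [e]
    exact Ideal.sum_mem _ fun l _ => Ideal.mul_mem_right _ _ (hdR' l)
  rw [Ideal.unit_mul_mem_iff_mem _ (isUnit_algebraMap_algebraMap_of_notMem p p' hp'B ht)] at h1
  have e3 : algebraMap B' R' y - φ a₂ = (algebraMap B' R' y - φ a) - φ (a₂ - a) := by
    rw [map_sub]; ring
  rw [e3]
  exact sub_mem h1 h2

end Local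


/-! ## Step 3: the affine Artin approximation theorem -/

section Main

variable {B : Type u} [CommRing B] [IsNoetherianRing B] (p : Ideal B) [p.IsPrime]
  (R : Type u) [CommRing R] [IsLocalRing R] [Algebra B R] [IsLocalization.AtPrime R p]

/-- **Artin approximation over étale neighbourhoods, affine form** (Artin 1969, Cor. 2.1;
Stacks 07QZ over a non-local base), PROVED from Popescu's theorem
(`Popescu1986_generalNeronDesingularization`) and Stacks 07M7 (`Stacks07M7_etaleLift`).
Let `B` be a Noetherian ring, `𝔭` a prime, `R` a localisation of `B` at `𝔭` such that
`B → R^` is a regular homomorphism, `F_j ∈ B[Y_i]` finitely many polynomials in finitely many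
variables, `ȳ` a solution of `F = 0` in `R^` and `N ≥ 0`. Then there are an étale `B`-algebra
`B'`, a prime `𝔭'` of `B'` over `𝔭`, and a solution `y` of `F = 0` in `B'` such that, for every
localisation `R'` of `B'` at `𝔭'` and every ring map `φ : R → R'` compatible with `B → B'`:
(1) every element of `R'` is congruent mod `𝔪_{R'}` to an element of `φ(R)` (the residue
extension `κ(𝔭) → κ(𝔭')` is trivial), and (2) `yᵢ ≡ φ(a) (mod 𝔪_{R'}^N)` whenever
`ȳᵢ ≡ a (mod 𝔪_R^N)`. [cite: StacksProject, Tag 07QZ] -/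
theorem exists_etale_solution_of_isRegularHom
    (hP : Popescu1986_generalNeronDesingularization.{u}) (hL : Stacks07M7_etaleLift.{u})
    (hreg : IsRegularHom B (AdicCompletion (maximalIdeal R) R))
    {ι κ : Type} [Finite ι] [Finite κ] (F : κ → MvPolynomial ι B)
    (ybar : ι → AdicCompletion (maximalIdeal R) R)
    (hF : ∀ j, MvPolynomial.aeval ybar (F j) = 0) (N : ℕ) :
    ∃ (B' : Type u) (_ : CommRing B') (_ : Algebra B B') (p' : Ideal B') (_ : p'.IsPrime)
      (y : ι → B'),
      Algebra.Etale B B' ∧ p'.comap (algebraMap B B') = p ∧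
      (∀ j, MvPolynomial.aeval y (F j) = 0) ∧
      ∀ (R' : Type u) [CommRing R'] [IsLocalRing R'] [Algebra B' R'] [IsLocalization.AtPrime R' p']
        (φ : R →+* R'), φ.comp (algebraMap B R) = (algebraMap B' R').comp (algebraMap B B') →
        (∀ x : R', ∃ r : R, x - φ r ∈ maximalIdeal R') ∧
        ∀ (i : ι) (a : R),
          AdicCompletion.evalₐ (maximalIdeal R) N (ybar i) = Ideal.Quotient.mk _ a →
            algebraMap B' R' (y i) - φ a ∈ maximalIdeal R' ^ N := by
  classical
  haveI : IsNoetherianRing R := IsLocalization.isNoetherianRing p.primeCompl R inferInstance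
  haveI : IsNoetherianRing (AdicCompletion (maximalIdeal R) R) :=
    isNoetherianRing_adicCompletion_maximalIdeal R
  obtain ⟨a, b, t, M, d, z, ha, ht, hab, hd, hz⟩ := exists_approximation_data p R ybar N
  -- the enlarged system `F(Y) = 0`, `tᵢ Yᵢ - bᵢ - Σ_l d_l Z_{il} = 0` over `B`
  let σ : Type := ι ⊕ (ι × Fin M)
  let G : ι → MvPolynomial σ B := fun i =>
    MvPolynomial.C (t i) * MvPolynomial.X (Sum.inl i) - MvPolynomial.C (b i) -
      ∑ l, MvPolynomial.C (d l) * MvPolynomial.X (Sum.inr (i, l))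
  let F' : κ → MvPolynomial σ B := fun j => MvPolynomial.rename Sum.inl (F j)
  let J : Ideal (MvPolynomial σ B) := Ideal.span (Set.range F' ∪ Set.range G)
  -- its solution `(ȳ, z)` in `R^`
  let ω : σ → AdicCompletion (maximalIdeal R) R := Sum.elim ybar fun il => z il.1 il.2
  have hωF : ∀ j, MvPolynomial.aeval ω (F' j) = 0 := fun j => by
    change MvPolynomial.aeval ω (MvPolynomial.rename Sum.inl (F j)) = 0
    rw [MvPolynomial.aeval_rename]
    exact hF j
  have hωG : ∀ i, MvPolynomial.aeval ω (G i) = 0 := fun i => by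
    change MvPolynomial.aeval ω (MvPolynomial.C (t i) * MvPolynomial.X (Sum.inl i) -
      MvPolynomial.C (b i) - ∑ l, MvPolynomial.C (d l) * MvPolynomial.X (Sum.inr (i, l))) = 0
    simp only [map_sub, map_mul, map_sum, MvPolynomial.aeval_C, MvPolynomial.aeval_X]
    change algebraMap B _ (t i) * ybar i - algebraMap B _ (b i) -
      ∑ l, algebraMap B _ (d l) * z i l = 0
    rw [hz i, sub_self]
  have hJ : ∀ g ∈ J, MvPolynomial.aeval ω g = 0 := by
    have hle : J ≤ RingHom.ker (MvPolynomial.aeval ω).toRingHom := by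
      change Ideal.span _ ≤ _
      rw [Ideal.span_le]
      rintro _ (⟨j, rfl⟩ | ⟨i, rfl⟩)
      · exact hωF j
      · exact hωG i
    exact fun g hg => hle hg
  let f : (MvPolynomial σ B ⧸ J) →ₐ[B] AdicCompletion (maximalIdeal R) R :=
    Ideal.Quotient.liftₐ J (MvPolynomial.aeval ω) hJ
  -- Popescu: the point factors through a smooth `B`-algebra `C`
  obtain ⟨C, _, _, hC, v, w, -⟩ :=
    hP B (AdicCompletion (maximalIdeal R) R) inferInstance inferInstance hreg
      (MvPolynomial σ B ⧸ J) inferInstance f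
  -- the section over the residue field descends to `B_t ⊗ C → B_t/𝔭B_t`
  let χ : C →ₐ[B] ResidueField R :=
    ((AdicCompletion.evalOneₐ (maximalIdeal R)).restrictScalars B).comp w
  obtain ⟨t₀, ht₀, ⟨σ'⟩⟩ := exists_away_section p R C χ
  -- Stacks 07M7 over `B_t` with the ideal `𝔭B_t`
  have hdisj : Disjoint ((Submonoid.powers t₀ : Submonoid B) : Set B) (p : Set B) := by
    rw [Set.disjoint_left]
    rintro _ ⟨n, rfl⟩ hn
    exact ht₀ (‹p.IsPrime›.mem_of_pow_mem n hn)
  haveI hpt : (p.map (algebraMap B (Localization.Away t₀))).IsPrime :=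
    IsLocalization.isPrime_of_isPrime_disjoint (Submonoid.powers t₀) _ p ‹_› hdisj
  obtain ⟨B', _, _, hEt, hbij, τ, -⟩ :=
    hL (Localization.Away t₀) (p.map (algebraMap B (Localization.Away t₀)))
      (Localization.Away t₀ ⊗[B] C) inferInstance σ'
  letI : Algebra B B' := ((algebraMap (Localization.Away t₀) B').comp
    (algebraMap B (Localization.Away t₀))).toAlgebra
  haveI : IsScalarTower B (Localization.Away t₀) B' := IsScalarTower.of_algebraMap_eq fun _ => rfl
  haveI : Algebra.Etale B (Localization.Away t₀) := Algebra.Etale.of_isLocalizationAway t₀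
  haveI := hEt
  have hEt' : Algebra.Etale B B' := Algebra.Etale.comp B (Localization.Away t₀) B'
  obtain ⟨hp'prime, hp'comap⟩ := isPrime_map_of_bijective_quotientMap
    (p.map (algebraMap B (Localization.Away t₀))) hbij
  set p' : Ideal B' := (p.map (algebraMap B (Localization.Away t₀))).map
    (algebraMap (Localization.Away t₀) B') with hp'def
  haveI := hp'prime
  have hp'B : p'.comap (algebraMap B B') = p := by
    rw [RingHom.algebraMap_toAlgebra, ← Ideal.comap_comap, hp'comap, ← Ideal.under_def]
    exact IsLocalization.under_map_of_isPrime_disjoint (Submonoid.powers t₀)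
      (Localization.Away t₀) ‹p.IsPrime› hdisj
  -- the solution: images of the variables under `B[Y, Z] → A → C → B_t ⊗ C → B'`
  let Φ : MvPolynomial σ B →ₐ[B] B' :=
    (τ.restrictScalars B).comp
      ((Algebra.TensorProduct.includeRight (R := B) (A := Localization.Away t₀) (B := C)).comp
        (v.comp (Ideal.Quotient.mkₐ B J)))
  have hΦJ : ∀ g ∈ J, Φ g = 0 := fun g hg => by
    change τ (Algebra.TensorProduct.includeRight (v (Ideal.Quotient.mkₐ B J g))) = 0
    rw [Ideal.Quotient.mkₐ_eq_mk, Ideal.Quotient.eq_zero_iff_mem.mpr hg, map_zero, map_zero,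
      map_zero]
  have hΦ : ∀ g, Φ g = MvPolynomial.aeval (fun v => Φ (MvPolynomial.X v)) g := fun g =>
    congrArg (fun ψ : MvPolynomial σ B →ₐ[B] B' => ψ g) (MvPolynomial.aeval_unique Φ)
  let y : ι → B' := fun i => Φ (MvPolynomial.X (Sum.inl i))
  let wz : ι × Fin M → B' := fun il => Φ (MvPolynomial.X (Sum.inr il))
  have hyw : (fun v : σ => Φ (MvPolynomial.X v)) = Sum.elim y wz := by
    ext v
    rcases v with i | il <;> rfl
  have hyF : ∀ j, MvPolynomial.aeval y (F j) = 0 := fun j => by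
    have h := hΦJ (F' j) (Ideal.subset_span (Or.inl ⟨j, rfl⟩))
    rw [hΦ, hyw] at h
    change MvPolynomial.aeval (Sum.elim y wz) (MvPolynomial.rename Sum.inl (F j)) = 0 at h
    rw [MvPolynomial.aeval_rename, Sum.elim_comp_inl] at h
    exact h
  have hyG : ∀ i, algebraMap B B' (t i) * y i - algebraMap B B' (b i) =
      ∑ l, algebraMap B B' (d l) * wz (i, l) := fun i => by
    have h := hΦJ (G i) (Ideal.subset_span (Or.inr ⟨i, rfl⟩))
    rw [hΦ, hyw] at h
    change MvPolynomial.aeval (Sum.elim y wz) (MvPolynomial.C (t i) * MvPolynomial.X (Sum.inl i) -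
      MvPolynomial.C (b i) - ∑ l, MvPolynomial.C (d l) * MvPolynomial.X (Sum.inr (i, l))) = 0 at h
    simp only [map_sub, map_mul, map_sum, MvPolynomial.aeval_C, MvPolynomial.aeval_X,
      Sum.elim_inl, Sum.elim_inr] at h
    exact sub_eq_zero.mp h
  refine ⟨B', inferInstance, inferInstance, p', hp'prime, y, hEt', hp'B, hyF, ?_⟩
  intro R' _ _ _ _ φ hφ
  have hsurj : ∀ b' : B', ∃ β : Localization.Away t₀, algebraMap _ B' β - b' ∈ p' := fun b' => by
    obtain ⟨q, hq⟩ := hbij.2 (Ideal.Quotient.mk _ b')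
    obtain ⟨β, rfl⟩ := Ideal.Quotient.mk_surjective q
    rw [Ideal.quotientMap_mk, Ideal.Quotient.eq] at hq
    exact ⟨β, hq⟩
  refine ⟨fun x => exists_sub_mem_maximalIdeal_of_surjective p t₀ ht₀ p' hp'B φ hφ hsurj x,
    fun i a₂ ha₂ => ?_⟩
  have ha₂' : a₂ - a i ∈ maximalIdeal R ^ N := by
    rw [← Ideal.Quotient.eq, ← ha₂, ha i]
  exact sub_mem_maximalIdeal_pow_of_eq_sum p p' hp'B φ hφ (ht i) (hab i) hd (hyG i) ha₂'

/-- **Artin approximation over étale neighbourhoods, affine form, for G-rings**: as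
`exists_etale_solution_of_isRegularHom`, the regularity of `B → R^` being supplied by the
G-ring property of `B` (`IsGRing.isRegularHom_comp_completion`; e.g. `B` of finite type over a
field, `Matsumura1987_32_6_cor`). [cite: StacksProject, Tag 07QZ] -/
theorem exists_etale_solution_of_isGRing
    (hP : Popescu1986_generalNeronDesingularization.{u}) (hL : Stacks07M7_etaleLift.{u})
    (hB : IsGRing B)
    {ι κ : Type} [Finite ι] [Finite κ] (F : κ → MvPolynomial ι B)
    (ybar : ι → AdicCompletion (maximalIdeal R) R)
    (hF : ∀ j, MvPolynomial.aeval ybar (F j) = 0) (N : ℕ) :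
    ∃ (B' : Type u) (_ : CommRing B') (_ : Algebra B B') (p' : Ideal B') (_ : p'.IsPrime)
      (y : ι → B'),
      Algebra.Etale B B' ∧ p'.comap (algebraMap B B') = p ∧
      (∀ j, MvPolynomial.aeval y (F j) = 0) ∧
      ∀ (R' : Type u) [CommRing R'] [IsLocalRing R'] [Algebra B' R'] [IsLocalization.AtPrime R' p']
        (φ : R →+* R'), φ.comp (algebraMap B R) = (algebraMap B' R').comp (algebraMap B B') →
        (∀ x : R', ∃ r : R, x - φ r ∈ maximalIdeal R') ∧
        ∀ (i : ι) (a : R),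
          AdicCompletion.evalₐ (maximalIdeal R) N (ybar i) = Ideal.Quotient.mk _ a →
            algebraMap B' R' (y i) - φ a ∈ maximalIdeal R' ^ N :=
  exists_etale_solution_of_isRegularHom p R hP hL (IsGRing.isRegularHom_comp_completion hB p R)
    F ybar hF N

end Main

end Literature.AlgebraicGeometry.Resolution

end
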